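import Literature.NumberTheory.GaloisRepresentations.LocalFieldDyadicPrincipalUnits
import HarnessLib

/-!
# Dyadic local field with `q = 2`, `e = 1`: square roots on `U_3` (Hensel), `U_{k+3} ⊆ (𝒪_F^×)^{2^{k+1}}`, `⋂ U_N = {1}`, and the
# KERNEL THEOREM — a character `ψ : 𝒪_F^× → 𝒪_F^×` with `ψ(γ) ∈ U_2 ∖ {1}` (`γ = 1 + π²w`) has `ker ψ ⊆ {±1}`, WITHOUT assuming continuity

Serre, *A Course in Arithmetic* (1973), Ch. II §3.2 Thm. 3, §3.3 (`ℤ₂^× = {±1} × (1 + 4ℤ₂)`, `1 + 4ℤ₂ ≅ ℤ₂` topologically generated by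
`5`, `(ℤ₂^×)² = 1 + 8ℤ₂`); Neukirch, *Algebraic Number Theory* (1999), Ch. II §4 Lemma (4.6) (Hensel), §5 Prop. (5.7).  De Shalit,
*Iwasawa theory of elliptic curves with complex multiplication* (1987), Ch. II §4.12 (29)–(33): the auxiliary ideals `𝔞₁, 𝔞₂` must make
`σ_{𝔞₁} − N𝔞₁`, `σ_{𝔞₂} − N𝔞₂` relatively prime — on the series side of the (c)-lane (`q = 2`) this is the non-vanishing of a CHARACTER
VALUE `ψ(χ_π(σ̃_{𝔞₂})) − N𝔞₂`, `ψ` the composite `𝒪_F^× → Λ^× → 𝒪_F^×` of the twist scalars `v ↦ t_v` with an evaluation; `ψ` is a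
homomorphism with `ψ(γ) = N𝔞₁`, and nothing else about it is cheap.  THIS file (sequel of `LocalFieldDyadicPrincipalUnits`; everything
PROVED, 0 sorry, no definitions, no named facts) shows that nothing else is needed:

* §4 ★ `exists_isUnit_sq_eq` — **`U_3 ⊆ (𝒪_F^×)²`** (Hensel for `Z² + Z − 2d`, `(1 + 2Z)² = 1 + 8d`; `𝒪_F` is `𝓂`-adically complete:
  Mathlib's `IsAdicComplete.henselianRing`); ★ `exists_isUnit_pow_two_pow_eq` — **`U_{k+3} ⊆ (𝒪_F^×)^{2^{k+1}}`** (iterate, normalising the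
  root into `U_2` by a sign and tracking its level by the exactness of squaring); `eq_one_of_forall_pi_pow_dvd` (`⋂_N U_N = {1}`).
* §5 for ANY `ψ : 𝒪_F^× → 𝒪_F` with `ψ 1 = 1`, `ψ(vv') = ψ(v)ψ(v')`: ★ `exists_pi_pow_dvd_sub_gen_pow_and_apply` — for `v ∈ U_2` and every
  `N` some `j` has `v ≡ γ^j` AND `ψ v ≡ ψ(γ)^j (mod π^{N+3})` (`vγ^{−j} = x^{2^{N+1}}` and `ψ(x)^{2^{N+1}} ∈ U_1^{2^{N+1}} ⊆ U_{N+3}`);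
  `pi_sq_dvd_apply_sub_one` (`ψ(U_2) ⊆ U_2` once `ψ γ ∈ U_2`); ★★ `units_eq_one_of_apply_eq_one_of_pi_sq_dvd` (on `U_2` the kernel is
  trivial: `ψ(γ)^j` has exact level `m₀ + v₂(j)`); ★★★ **`units_eq_one_or_eq_neg_one_of_apply_eq_one`** — `ψ γ ∈ U_2`, `ψ γ ≠ 1`,
  `ψ v = 1 ⟹ v = 1 ∨ v = −1`; ★★ `units_eq_or_eq_neg_of_apply_eq` (`ψ v = ψ v' ⟹ v = ±v'`).

## References
* J.-P. Serre, *A Course in Arithmetic* (1973), Ch. II §3.2 Thm. 3 and its proof, §3.3. [Serre1973CourseArithmetic]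
* J.-P. Serre, *Local Fields* (1979), Ch. I §1 (discrete valuation rings: uniformiser, units, `𝓂 = (π)`). [SerreLocalFields1979]
* J. Neukirch, *Algebraic Number Theory* (1999), Ch. II §4 Lemma (4.6), §5 Prop. (5.7). [NeukirchANT1999]
* E. de Shalit, *Iwasawa theory of elliptic curves with complex multiplication* (1987), Ch. I §3.1; Ch. II §4.12 (29)–(33). [deShalit1987]
-/

noncomputable section

namespace Literature.NumberTheory.GaloisRepresentations

section DyadicCharacterKernel

open GaloisRepresentations.IsNonarchimedeanLocalField LubinTate ValuativeRel

variable {F : Type} [Field F] [ValuativeRel F] [TopologicalSpace F] [IsNonarchimedeanLocalField F]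

attribute [local instance] ltNormUniformSpace ltNormIsUniformAddGroup rk1 nF nE fintypeResidueField

variable {π : 𝒪[F]} (hπ : (valuation F).IsUniformizer (π : F)) (hq : residueFieldCard F = 2)
variable {t : 𝒪[F]ˣ} (ht : (2 : 𝒪[F]) = π * t)

/-! ### §4. Square roots on `U_3` (Hensel) and `⋂ U_N = {1}` -/

include hπ ht in
/-- ★ **`U_3 ⊆ (𝒪_F^×)²`**: `π³ ∣ c − 1 ⟹ c = x²` for a unit `x` (Hensel for `Z² + Z − 2d`, `c = 1 + 8d`, `x = 1 + 2Z`; `𝒪_F` is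
`𝓂`-adically complete).  [cite: NeukirchANT1999, Ch. II §4 Lemma (4.6)] [cite: Serre1973CourseArithmetic, Ch. II §3.3] -/
theorem exists_isUnit_sq_eq {c : 𝒪[F]} (hc : π ^ 3 ∣ c - 1) : ∃ x : 𝒪[F], IsUnit x ∧ x ^ 2 = c := by
  obtain ⟨e, he⟩ := hc
  set d : 𝒪[F] := ((t⁻¹ : 𝒪[F]ˣ) : 𝒪[F]) ^ 3 * e with hd
  have h8 : (8 : 𝒪[F]) * d = π ^ 3 * e := by
    have h8' : (8 : 𝒪[F]) = (π * t) ^ 3 := by rw [← ht]; norm_num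
    rw [h8', hd, mul_pow, ← mul_assoc, mul_assoc (π ^ 3), ← mul_pow, Units.mul_inv, one_pow, mul_one]
  have hπm : π ∈ 𝓂[F] := (mem_maximalIdeal_iff_valuation_lt_one _).mpr hπ.val_lt_one
  set f : Polynomial 𝒪[F] := Polynomial.X ^ 2 + Polynomial.X - Polynomial.C (2 * d) with hf
  have hmonic : f.Monic := by
    have h : f = Polynomial.X ^ 2 + (Polynomial.X - Polynomial.C (2 * d)) := by rw [hf]; ring
    rw [h]
    refine (Polynomial.monic_X_pow 2).add_of_left ?_
    rw [Polynomial.degree_X_pow]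
    exact (Polynomial.degree_X_sub_C _).trans_lt (by norm_num)
  have h0 : f.eval 0 ∈ 𝓂[F] := by
    have h : f.eval 0 = -(π * (t * d)) := by rw [← mul_assoc, ← ht, hf]; simp
    rw [h]
    exact neg_mem (Ideal.mul_mem_right _ _ hπm)
  have h1 : IsUnit (Ideal.Quotient.mk 𝓂[F] (f.derivative.eval 0)) := by
    have h : f.derivative.eval 0 = 1 := by rw [hf]; simp
    rw [h, map_one]; exact isUnit_one
  obtain ⟨Z, hZ, -⟩ := HenselianRing.is_henselian (I := 𝓂[F]) f hmonic 0 h0 h1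
  have hZ' : Z ^ 2 + Z - 2 * d = 0 := by
    have h := hZ.eq_zero
    rwa [hf, Polynomial.eval_sub, Polynomial.eval_add, Polynomial.eval_pow, Polynomial.eval_X, Polynomial.eval_C] at h
  refine ⟨1 + 2 * Z, isUnit_of_uniformizer_dvd_sub_one hπ ⟨t * Z, by rw [← mul_assoc, ← ht]; ring⟩, ?_⟩
  have hc' : c = 1 + 8 * d := by rw [h8, ← he]; ring
  rw [hc']
  linear_combination 4 * hZ'

include hπ hq ht in
/-- ★ **`U_{k+3} ⊆ (𝒪_F^×)^{2^{k+1}}`**: `π^{k+3} ∣ c − 1 ⟹ c = x^{2^{k+1}}` for a unit `x` (iterate the square root, normalised into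
`U_2` by a sign, and keep track of the level by the exactness of squaring).  [cite: Serre1973CourseArithmetic, Ch. II §3.3]
[cite: NeukirchANT1999, Ch. II §5 Prop. (5.7)] -/
theorem exists_isUnit_pow_two_pow_eq (k : ℕ) {c : 𝒪[F]} (hc : π ^ (k + 3) ∣ c - 1) : ∃ x : 𝒪[F], IsUnit x ∧ x ^ 2 ^ (k + 1) = c := by
  induction k generalizing c with
  | zero => simpa using exists_isUnit_sq_eq hπ ht hc
  | succ k ih =>
    obtain ⟨x, hxu, hx⟩ := exists_isUnit_sq_eq hπ ht ((pow_dvd_pow π (by omega)).trans hc)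
    -- normalise the square root into `U_2`
    obtain ⟨y, hyu, hy2, hy⟩ : ∃ y : 𝒪[F], IsUnit y ∧ π ^ 2 ∣ y - 1 ∧ y ^ 2 = c := by
      rcases pi_sq_dvd_sub_one_or_add_one hπ hq ht hxu with h | h
      · exact ⟨x, hxu, h, hx⟩
      · exact ⟨-x, hxu.neg, by rw [← dvd_neg, show -(-x - 1) = x + 1 by ring]; exact h, by rw [neg_sq, hx]⟩
    -- its level is at least `k + 3`
    have hyk : π ^ (k + 3) ∣ y - 1 := by
      by_contra hnot
      obtain ⟨m, h2m, hmk, hm, hm'⟩ := exists_pi_pow_dvd_not_dvd_succ hy2 hnot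
      have hsq := not_pi_pow_dvd_sq_sub_one hπ ht h2m hm hm'
      rw [hy] at hsq
      exact hsq ((pow_dvd_pow π (by omega)).trans hc)
    obtain ⟨z, hzu, hz⟩ := ih hyk
    exact ⟨z, hzu, by rw [pow_succ, pow_mul, hz, hy]⟩

include hπ in
/-- **`⋂_N U_N = {1}`**: `π^N ∣ x − 1` for all `N ⟹ x = 1` (`𝒪_F` is `𝓂`-adically separated). [cite: SerreLocalFields1979, Ch. I §1] -/
theorem eq_one_of_forall_pi_pow_dvd {x : 𝒪[F]} (h : ∀ N : ℕ, π ^ N ∣ x - 1) : x = 1 := by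
  have hx : x - 1 = 0 := IsHausdorff.haus (inferInstance : IsHausdorff 𝓂[F] 𝒪[F]) (x - 1) fun N =>
    SModEq.zero.mpr ((mem_maximalIdeal_pow_smul_top_iff hπ).mpr (h N))
  exact sub_eq_zero.mp hx

/-! ### §5. The kernel of a character `ψ` with `ψ(γ) ∈ U_2 ∖ {1}` is `⊆ {±1}` -/

section Kernel

variable (ψ : 𝒪[F]ˣ → 𝒪[F]) (hone : ψ 1 = 1) (hmul : ∀ v v' : 𝒪[F]ˣ, ψ (v * v') = ψ v * ψ v')

include hone hmul in
omit [TopologicalSpace F] [IsNonarchimedeanLocalField F] in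
/-- A multiplicative `ψ` with `ψ 1 = 1` takes unit values. [cite: SerreLocalFields1979, Ch. I §1] -/
theorem isUnit_apply_units_of_map_mul (v : 𝒪[F]ˣ) : IsUnit (ψ v) :=
  IsUnit.of_mul_eq_one (ψ v⁻¹) (by rw [← hmul, mul_inv_cancel, hone])

include hmul hone in
omit [TopologicalSpace F] [IsNonarchimedeanLocalField F] in
/-- `ψ (v^j) = (ψ v)^j`. [cite: SerreLocalFields1979, Ch. I §1] -/
theorem apply_units_pow_of_map_mul (v : 𝒪[F]ˣ) (j : ℕ) : ψ (v ^ j) = ψ v ^ j := by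
  induction j with
  | zero => rw [pow_zero, pow_zero, hone]
  | succ j ih => rw [pow_succ, hmul, ih, pow_succ]

variable {γ w : 𝒪[F]ˣ} (hγ : (γ : 𝒪[F]) = 1 + π ^ 2 * w)

include hπ hq ht hone hmul hγ in
/-- ★ **KEY APPROXIMATION (no continuity assumed)**: for `v ∈ U_2` and every `N` there is `j` with `v ≡ γ^j` AND `ψ v ≡ (ψ γ)^j
(mod π^{N+3})` — because `v γ^{−j} ∈ U_{N+3}` is a `2^{N+1}`-th power `x^{2^{N+1}}` and `ψ(x)^{2^{N+1}} ∈ U_1^{2^{N+1}} ⊆ U_{N+3}`.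
[cite: Serre1973CourseArithmetic, Ch. II §3.2 Thm. 3, §3.3] [cite: deShalit1987, Ch. I §3.1] -/
theorem exists_pi_pow_dvd_sub_gen_pow_and_apply {v : 𝒪[F]ˣ} (hv : π ^ 2 ∣ (v : 𝒪[F]) - 1) (N : ℕ) :
    ∃ j : ℕ, π ^ (N + 3) ∣ (v : 𝒪[F]) - (γ : 𝒪[F]) ^ j ∧ π ^ (N + 3) ∣ ψ v - ψ γ ^ j := by
  obtain ⟨j, hj⟩ := exists_pi_pow_dvd_sub_gen_pow hπ hq ht hγ hv (N + 3)
  refine ⟨j, hj, ?_⟩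
  -- `u := v γ^{-j} ∈ U_{N+3}`
  set u : 𝒪[F]ˣ := v * (γ ^ j)⁻¹ with hu
  have hu1 : π ^ (N + 3) ∣ (u : 𝒪[F]) - 1 := by
    have hgi : (γ : 𝒪[F]) ^ j * (((γ ^ j)⁻¹ : 𝒪[F]ˣ) : 𝒪[F]) = 1 := by rw [← Units.val_pow_eq_pow_val, Units.mul_inv]
    have e : (u : 𝒪[F]) - 1 = ((v : 𝒪[F]) - (γ : 𝒪[F]) ^ j) * (((γ ^ j)⁻¹ : 𝒪[F]ˣ) : 𝒪[F]) := by
      rw [hu, Units.val_mul]; linear_combination hgi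
    rw [e]; exact hj.mul_right _
  -- `u = x^{2^{N+1}}`
  obtain ⟨x, hxu, hx⟩ := exists_isUnit_pow_two_pow_eq hπ hq ht N hu1
  have hux : u = hxu.unit ^ 2 ^ (N + 1) := Units.ext (by rw [Units.val_pow_eq_pow_val, IsUnit.unit_spec, hx])
  have hψu : π ^ (N + 3) ∣ ψ u - 1 := by
    rw [hux, apply_units_pow_of_map_mul ψ hone hmul]
    exact pi_pow_dvd_pow_two_pow_succ_sub_one_of_isUnit hπ hq ht (isUnit_apply_units_of_map_mul ψ hone hmul _) N
  have hv' : v = γ ^ j * u := by rw [hu, mul_comm, inv_mul_cancel_right]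
  have e : ψ v - ψ γ ^ j = ψ γ ^ j * (ψ u - 1) := by
    rw [hv', hmul, apply_units_pow_of_map_mul ψ hone hmul, mul_sub, mul_one]
  rw [e]
  exact hψu.mul_left _

include hπ hq ht hone hmul hγ in
/-- **`ψ(U_2) ⊆ U_2` as soon as `ψ γ ∈ U_2`.** [cite: Serre1973CourseArithmetic, Ch. II §3.3] -/
theorem pi_sq_dvd_apply_sub_one (hψγ : π ^ 2 ∣ ψ γ - 1) {v : 𝒪[F]ˣ} (hv : π ^ 2 ∣ (v : 𝒪[F]) - 1) : π ^ 2 ∣ ψ v - 1 := by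
  obtain ⟨j, -, hj⟩ := exists_pi_pow_dvd_sub_gen_pow_and_apply hπ hq ht ψ hone hmul hγ hv 0
  have e : ψ v - 1 = (ψ v - ψ γ ^ j) + (ψ γ ^ j - 1) := by ring
  rw [e]
  exact dvd_add ((pow_dvd_pow π (by norm_num)).trans hj) (pi_pow_dvd_pow_sub_one hψγ j)

include hπ hq ht hone hmul hγ in
/-- ★★ **On `U_2` the kernel is trivial**: `v ∈ U_2`, `ψ v = 1`, `ψ γ ∈ U_2 ∖ {1} ⟹ v = 1` (`v ≡ γ^j`, `1 = ψ v ≡ ψ(γ)^j (π^{N'})` with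
`ψ(γ)^j` of exact level `m₀ + v₂(j)` forces `2^{N'−m₀} ∣ j`, so `v ≡ 1 (π^{N'+2−m₀})` for every `N'`).
[cite: Serre1973CourseArithmetic, Ch. II §3.2 Thm. 3, §3.3] [cite: deShalit1987, Ch. II §4.12 (29)–(33)] -/
theorem units_eq_one_of_apply_eq_one_of_pi_sq_dvd (hψγ : π ^ 2 ∣ ψ γ - 1) (hψγ1 : ψ γ ≠ 1) {v : 𝒪[F]ˣ}
    (hv : π ^ 2 ∣ (v : 𝒪[F]) - 1) (hψv : ψ v = 1) : v = 1 := by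
  -- exact level `m₀ = m₀' + 2` of `ψ γ`
  obtain ⟨b, hb⟩ : ∃ b, ¬ π ^ b ∣ ψ γ - 1 := by
    by_contra h
    push Not at h
    exact hψγ1 (eq_one_of_forall_pi_pow_dvd hπ h)
  obtain ⟨m₀, h2m₀, -, hm₀, hm₀'⟩ := exists_pi_pow_dvd_not_dvd_succ hψγ hb
  obtain ⟨m₀', rfl⟩ : ∃ m₀', m₀ = m₀' + 2 := ⟨m₀ - 2, by omega⟩
  refine Units.ext ?_
  rw [Units.val_one]
  refine eq_one_of_forall_pi_pow_dvd hπ fun N => ?_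
  obtain ⟨j, hvj, hψj⟩ := exists_pi_pow_dvd_sub_gen_pow_and_apply hπ hq ht ψ hone hmul hγ hv (N + m₀')
  rw [hψv, ← dvd_neg, neg_sub] at hψj
  -- `π^N ∣ γ^j - 1`
  have hγj : π ^ N ∣ (γ : 𝒪[F]) ^ j - 1 := by
    rcases Nat.eq_zero_or_pos j with rfl | hj0
    · simp
    obtain ⟨a, i', hi', rfl⟩ := Nat.exists_eq_two_pow_mul_odd hj0.ne'
    obtain ⟨i, rfl⟩ := hi'
    have hlev := pi_pow_dvd_pow_sub_one_and_not hπ ht (by omega) hm₀ hm₀' a i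
    -- `N + m₀' + 3 ≤ m₀' + 2 + a`, i.e. `N + 1 ≤ a`
    have hNa : N + 1 ≤ a := by
      by_contra hlt
      exact hlev.2 ((pow_dvd_pow π (by omega)).trans hψj)
    have hg := (pi_pow_dvd_gen_pow_two_pow_sub_one_and_not hπ ht hγ a).1
    rw [pow_mul]
    exact (pow_dvd_pow π (by omega)).trans (pi_pow_dvd_pow_sub_one hg (2 * i + 1))
  have e : (v : 𝒪[F]) - 1 = ((v : 𝒪[F]) - (γ : 𝒪[F]) ^ j) + ((γ : 𝒪[F]) ^ j - 1) := by ring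
  rw [e]
  exact dvd_add ((pow_dvd_pow π (by omega)).trans hvj) hγj

include hπ hq ht hone hmul hγ in
/-- ★★★ **KERNEL THEOREM**: for a multiplicative `ψ : 𝒪_F^× → 𝒪_F` (`ψ 1 = 1`) on a dyadic field with `q = 2`, `e = 1`, if
`ψ(γ) ∈ U_2 ∖ {1}` for the topological generator `γ = 1 + π²w`, then **`ψ v = 1 ⟹ v = 1 ∨ v = −1`**.  NO continuity is assumed
(it is forced on `U_2` by `U_{N+3} ⊆ (𝒪^×)^{2^{N+1}}`).  This is the series-side content of de Shalit's choice of the auxiliary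
ideal `𝔞₂` in II §4.12 at `p = 2` (see `LubinTateColemanCoordCoinvariantTwistKernelTwo`).
[cite: Serre1973CourseArithmetic, Ch. II §3.2 Thm. 3, §3.3] [cite: deShalit1987, Ch. I §3.1; Ch. II §4.12 (29)–(33)] -/
theorem units_eq_one_or_eq_neg_one_of_apply_eq_one (hψγ : π ^ 2 ∣ ψ γ - 1) (hψγ1 : ψ γ ≠ 1) {v : 𝒪[F]ˣ} (hψv : ψ v = 1) :
    v = 1 ∨ v = -1 := by
  rcases pi_sq_dvd_sub_one_or_add_one hπ hq ht v.isUnit with hv | hv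
  · exact Or.inl (units_eq_one_of_apply_eq_one_of_pi_sq_dvd hπ hq ht ψ hone hmul hγ hψγ hψγ1 hv hψv)
  · right
    have hv' : π ^ 2 ∣ ((-v : 𝒪[F]ˣ) : 𝒪[F]) - 1 := by
      rw [Units.val_neg, ← dvd_neg, show -(-(v : 𝒪[F]) - 1) = (v : 𝒪[F]) + 1 by ring]; exact hv
    have he2 : ψ (-1) * ψ (-1) = 1 := by rw [← hmul, neg_mul_neg, one_mul, hone]
    have hψv' : ψ (-v) = ψ (-1) := by rw [← neg_one_mul, hmul, hψv, mul_one]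
    haveI : IsDomain 𝒪[F] := inferInstance
    rcases mul_self_eq_one_iff.mp he2 with he | he
    · rw [he] at hψv'
      have h := units_eq_one_of_apply_eq_one_of_pi_sq_dvd hπ hq ht ψ hone hmul hγ hψγ hψγ1 hv' hψv'
      rw [neg_eq_iff_eq_neg] at h
      exact h
    · exfalso
      rw [he] at hψv'
      have h2 := pi_sq_dvd_apply_sub_one hπ hq ht ψ hone hmul hγ hψγ hv'
      rw [hψv'] at h2
      exact not_pi_sq_dvd_neg_one_sub_one hπ ht h2

include hπ hq ht hone hmul hγ in
/-- ★★ **`ψ v = ψ v' ⟹ v = ±v'`** under the same hypotheses. [cite: deShalit1987, Ch. II §4.12 (29)–(33)]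
[cite: Serre1973CourseArithmetic, Ch. II §3.2 Thm. 3] -/
theorem units_eq_or_eq_neg_of_apply_eq (hψγ : π ^ 2 ∣ ψ γ - 1) (hψγ1 : ψ γ ≠ 1) {v v' : 𝒪[F]ˣ} (hvv' : ψ v = ψ v') :
    v = v' ∨ v = -v' := by
  have h1 : ψ (v * v'⁻¹) = 1 := by
    rw [hmul, hvv', ← hmul, mul_inv_cancel, hone]
  rcases units_eq_one_or_eq_neg_one_of_apply_eq_one hπ hq ht ψ hone hmul hγ hψγ hψγ1 h1 with h | h
  · exact Or.inl (mul_inv_eq_one.mp h)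
  · right
    rw [mul_inv_eq_iff_eq_mul, neg_one_mul] at h
    exact h

end Kernel

end DyadicCharacterKernel

end Literature.NumberTheory.GaloisRepresentations
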